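import Literature.MathematicalPhysics.QuantumFieldTheory.Balaban1983to89.B9Eq326OperatorTower

/-!
# `Balaban1983to89.B9Eq319QprimeTowerCentre` — T. Bałaban, *Propagators for lattice gauge theories in a background field*, Commun. Math.
# Phys. **99** (1985) 389–434 [Balaban1985BackgroundPropagators] (3.19) p. 393 with (3.15) p. 393 and (3.11) p. 392: THE COMPOSITE
# GAUGE-PARAMETER AVERAGING `Q′_k(U) = Q′(Ū^{k−1})⋯Q′(U)` OF THE TOWER `T_{L^k m} → ⋯ → T_m` HAS A UNIVERSAL RIGHT INVERSE — the
# composite of the one-step CENTRE EXTENSIONS, ONE linear section `S_k` with `Q′_k(U) ∘ S_k = id` FOR EVERY BACKGROUND `U` (indeed for every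
# family of level transporters), an `ℓ²`-scaling by `(L^d)^k` (volume-free), bounded by `(L^d)^k` pointwise and by `(L^d)^k·√(c₀·#T_m)` from
# the sup norm into `L²`

statement-level skeleton of published theorems with citation tags; proofs where landed; nothing here is a claim about the Yang–Mills mass gap

PDF held: `paper:balaban1985-cmp99-background-propagators` (journal page = PDF page + 388); p. 393 read by this seat (2026-08-22) in the
held text layer (p0005).  THE PRINT.  p. 393: *«We are interested in the linear operators Q_j(U). They are compositions of j one-step averaging
operators Q_j(U) = Q(Ū^{j−1})…Q(Ū)Q(U) (3.15)»*; (3.18)–(3.19) p. 393 define the gauge-parameter averagings `Q′_j(U) = Q′(Ū^{j−1})⋯Q′(Ū)Q′(U)`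
as the composites of the one-step `(Q′(V)λ)(y) = Σ_{x∈B(y)} L^{−d} R(V(Γ_{y,x}))λ(x)` (quoted in `B9Eq319QprimeTorus`), *«The contours Γ_{y,x},
x ∈ B_j(y), and the contour variables U(Γ_{y,x}) were defined by (52), (53) in [5].»*  The right inverse below is NOT in print — print uses only
«Q′ onto» (for `(Q′G′²Q′*)⁻¹` of (3.25), cf. `B9Eq319QprimeTorus.Qprime_surjective`); it is the cell's [folklore] device that makes the displayed
sections of the tower files explicit and background-independent.  NEAREST PRINT for a right inverse of a block averaging (presearch 2026-08-22):
J. Dimock, *Multiscale block averaging for QED in d = 3*, arXiv:1712.10029, p. 27: *«This satisfies QQ^{s,T} = I»* — the transpose of the surface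
averaging as a right inverse of the ABELIAN, non-covariant `Q`; for the covariant `Q′_k(U)` of (3.19) the constant-on-blocks extension is not a right
inverse (the contour transports intervene), the CENTRE extension is — the contour `Γ_{y,y}` of a centre is empty — and for every `U` at once.

CITATION HEADER (lean-in-tree rule 2026-08-18).  Audit cell `pub-balaban`, sub-cell `t4`, NE9 crux team (2): LEAF PROVER 02
(`b2b-balaban-t4-ne9-formalise-leaf-02` gen 62), on the NE9 row OWNER's OFFER O-ne9p1-g83-2 (journal `CLAIMS.log` l.44344) — the named
interface that DISCHARGES the displayed right inverses `(S₁, S₂, CS)` of the owner's `B9Thm311SmallFieldCoercivityTower` §3∕§4 with ONE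
`U`-independent section.  The one-step case is NE9 leaf-04's `B9Eq384RemainderLetters` §3 (`QprimeW_centre`, `norm_centre_le`); this file
iterates it along the tower of `B9Eq315QTower` (§5 `QprimeTower`) and reads it on the `L²` carrier of `B9Eq326OperatorTower.QprimeTowerW`.

WHAT IS PROVED (sorry-free; no `def`; no `Prop` placeholder; no inequality of the paper asserted).
* §1 `centreFun_add'` ∕ `centreFun_smul'` ∕ `norm_centreFun_le` ∕ `sum_norm_sq_centreFun` — the centre extension `ω ↦ λ_ω` (value `L^d·ω(y)`
  at the centre of the block `B(y)`, `0` elsewhere) is `ℂ`-linear, pointwise bounded by `L^d·‖ω‖_∞`, and an `ℓ²`-SCALING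
  (`Σ_x ‖λ_ω(x)‖² = L^{2d}·Σ_y ‖ω(y)‖²`), for any torus and any normed `ℂ`-space. [folklore]
* §2 **`exists_QprimeTower_rightInverse`** — for every `k` THERE IS a linear `S_k : (T_m → V) → (T_{L^k m} → V)` with
  `Q′_k(Rlev)(S_k f) = f` for EVERY family `Rlev` of level transporters (the contour of a centre is empty, `B9Eq319QprimeTorus.Qprime_centreFun`,
  at each level), `‖(S_k f)(x)‖ ≤ (L^d)^k·‖f‖_∞` and `Σ_x ‖(S_k f)(x)‖² = (L^d)^{2k}·Σ_y ‖f(y)‖²` (NO site count); the witness (`S_0 = id`,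
  `S_{k+1} = λ_{(·)} ∘ S_k`) is built inside the proof.
* §3 **`exists_QprimeTowerW_rightInverse`** — the OWNER's currency: for every `n` THERE IS `S : (T_m → W) →ₗ[ℂ] L²(T_{L^{n+1} m}; c₀; W)` with
  `QprimeTowerW L m n φ U (S f) = f` for EVERY fibre reading `φ` and EVERY background `U`, the VOLUME-FREE identity
  `‖S f‖²_{L²(c₀)} = c₀·(L^d)^{2(n+1)}·Σ_y ‖f(y)‖²`, and the crude sup-norm bound `‖S f‖_{L²} ≤ (L^d)^{n+1}·√(c₀·#T_m)·‖f‖_∞` (COARSE site count).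
MODEL / HONEST SCOPE.  [folklore] finite-lattice linear algebra; the sup-norm constant carries `√#T_m` (NOT uniform in the volume, the one-step
`norm_centre_le` currency with the coarse count); the `L²`-identity is volume-free; NOT the tower Lipschitz letters `ρ′_k`, `δ_{Q,k}`; nothing of
[B9] Thms 3.1–3.13 asserted; a displayed binder of a
cell file discharged, nothing more; NOT summit progress (cell pub-balaban: NE9 NOT PRINTED ∕ NOT PROVED; spine PROVED 0∕9; rung (B)+1 finite T⁴ —
NOT infinite volume, NOT mass gap, NOT Clay).  NEW file importing `B9Eq326OperatorTower` only; nothing of the NE9-owner ∕ leaf-03 ∕ leaf-04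
lineages' files is modified or restated.  Net new unproved facts: 0.
-/

noncomputable section

open scoped BigOperators

namespace Literature.MathematicalPhysics.QuantumFieldTheory.Balaban1983to89.B9Eq319QprimeTowerCentre

open B4Sect5Torus (TSite)
open B9SectCLatticeCarrier (Bond)
open B9Eq311L2Pairing (WL2)
open B11Eq103H1Complex (SiteL2K)
open B9Eq319Onto (centreFun centreFun_centre centreFun_off_centre)
open B9Eq319QprimeTorus (fineP centre weight Qprime_centreFun QprimeLin QprimeLin_apply centre_injective)
open B9Eq315QTower (towerP QprimeTower QprimeTower_succ)
open B9Eq326OperatorTower (QprimeTowerW)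

/-! ## §1 The one-step centre extension on a general torus: linear, pointwise `L^d`-bounded -/

section OneStep

variable {d : ℕ} (L : ℕ) [NeZero L] (P : Fin d → ℕ) {V : Type*} [NormedAddCommGroup V] [NormedSpace ℂ V]

/-- the centre extension is additive (any torus, any `ℂ`-space; the `T_m`-case for the fibre `W` is `B9Eq384RemainderLetters.centreFun_add`).
[folklore] [cite: Balaban1985BackgroundPropagators, (3.19) p.393] -/
theorem centreFun_add' (ω ω' : TSite d P → V) :
    centreFun (weight L P) (centre L P) (ω + ω') = centreFun (weight L P) (centre L P) ω + centreFun (weight L P) (centre L P) ω' := by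
  funext x
  simp only [centreFun, Pi.add_apply]
  split_ifs <;> simp [smul_add]

/-- the centre extension is `ℂ`-homogeneous. [folklore] [cite: Balaban1985BackgroundPropagators, (3.19) p.393] -/
theorem centreFun_smul' (r : ℂ) (ω : TSite d P → V) :
    centreFun (weight L P) (centre L P) (r • ω) = r • centreFun (weight L P) (centre L P) ω := by
  funext x
  simp only [centreFun, Pi.smul_apply]
  split_ifs
  · exact smul_comm _ _ _
  · exact (smul_zero _).symm

/-- **the centre extension is pointwise `L^d`-bounded**: its value is `L^d • ω(y)` at the centre of `B(y)` and `0` off the centres.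
[folklore] [cite: Balaban1985BackgroundPropagators, (3.19) p.393] -/
theorem norm_centreFun_le (ω : TSite d P → V) (x : TSite d (fineP L P)) :
    ‖centreFun (weight L P) (centre L P) ω x‖ ≤ (L : ℝ) ^ d * ‖ω‖ := by
  unfold centreFun
  split_ifs with h
  · rw [norm_smul, weight, inv_inv, norm_pow, Real.norm_natCast]
    exact mul_le_mul_of_nonneg_left (norm_le_pi_norm ω _) (by positivity)
  · rw [norm_zero]; positivity

/-- **the centre extension is an `ℓ²`-SCALING**: `Σ_x ‖λ_ω(x)‖² = (L^d)²·Σ_y ‖ω(y)‖²` — it is supported on the centres (`centre` injective),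
where its value is `L^d • ω(y)`; NO site count enters. [folklore] [cite: Balaban1985BackgroundPropagators, (3.19) p.393, (3.11) p.392] -/
theorem sum_norm_sq_centreFun (ω : TSite d P → V) :
    ∑ x : TSite d (fineP L P), ‖centreFun (weight L P) (centre L P) ω x‖ ^ 2 = ((L : ℝ) ^ d) ^ 2 * ∑ y : TSite d P, ‖ω y‖ ^ 2 := by
  classical
  have hoff : ∀ x ∈ (Finset.univ : Finset (TSite d (fineP L P))), x ∉ Finset.univ.image (centre L P) →
      ‖centreFun (weight L P) (centre L P) ω x‖ ^ 2 = 0 := by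
    intro x _ hx
    rw [centreFun_off_centre _ _ _ _ (fun c hc => hx (Finset.mem_image.2 ⟨c, Finset.mem_univ _, hc⟩)), norm_zero]
    simp
  rw [← Finset.sum_subset (Finset.subset_univ (Finset.univ.image (centre L P))) hoff,
    Finset.sum_image fun y _ y' _ h => centre_injective L P h, Finset.mul_sum]
  refine Finset.sum_congr rfl fun y _ => ?_
  rw [centreFun_centre _ _ (centre_injective L P), norm_smul, weight, inv_inv, norm_pow, Real.norm_natCast, mul_pow]

/-- `Q′(Rb)` of the centre extension returns the coarse function, for EVERY transporter family `Rb` (the contour of a centre is empty) — the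
`ℂ`-linear reading of `B9Eq319QprimeTorus.Qprime_centreFun`. [cite: Balaban1985BackgroundPropagators, (3.19) p.393] -/
theorem QprimeLin_centreFun (Rb : Bond d (fineP L P) → V →ₗ[ℂ] V) (ω : TSite d P → V) :
    QprimeLin L P Rb (centreFun (weight L P) (centre L P) ω) = ω := by
  funext y
  rw [QprimeLin_apply]
  exact Qprime_centreFun L P _ ω y

end OneStep

/-! ## §2 The universal right inverse of `Q′_k` on the tower (function level) -/

section Tower

variable {d : ℕ} (L : ℕ) [NeZero L] (m : Fin d → ℕ) {V : Type*} [NormedAddCommGroup V] [NormedSpace ℂ V]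

/-- **THE UNIVERSAL RIGHT INVERSE OF THE COMPOSITE `Q′_k`**: for every number of levels `k` there is ONE linear section
`S_k : (T_m → V) →ₗ (T_{L^k m} → V)` — the composite of the centre extensions, finest last — with `Q′_k(Rlev)(S_k f) = f` for EVERY family
`Rlev` of level transporters (so for `R(Ū^j(Γ))` of every background `U`, and for the flat ones), and `‖(S_k f)(x)‖ ≤ (L^d)^k·‖f‖_∞` at every
site.  The witness is built inside the proof (`S_0 = id`, `S_{k+1} = λ_{(·)} ∘ S_k`). [folklore]
[cite: Balaban1985BackgroundPropagators, (3.19) p.393, (3.15) p.393] -/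
theorem exists_QprimeTower_rightInverse : ∀ k : ℕ,
    ∃ S : (TSite d m → V) →ₗ[ℂ] (TSite d (towerP L m k) → V),
      (∀ (Rlev : (n : ℕ) → Bond d (towerP L m (n + 1)) → V →ₗ[ℂ] V) (f : TSite d m → V), QprimeTower L m Rlev k (S f) = f) ∧
      (∀ (f : TSite d m → V) (x : TSite d (towerP L m k)), ‖S f x‖ ≤ ((L : ℝ) ^ d) ^ k * ‖f‖) ∧
      ∀ f : TSite d m → V, ∑ x : TSite d (towerP L m k), ‖S f x‖ ^ 2 = (((L : ℝ) ^ d) ^ k) ^ 2 * ∑ y : TSite d m, ‖f y‖ ^ 2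
  | 0 => ⟨LinearMap.id, fun _ _ => rfl, fun f x => by
      rw [pow_zero, one_mul]; exact norm_le_pi_norm f x, fun f => by
      rw [pow_zero, one_pow, one_mul]; rfl⟩
  | k + 1 => by
      obtain ⟨S, hS, hSn, hS2⟩ := exists_QprimeTower_rightInverse k
      -- the centre extension at level `k`, as a linear map `(T_{L^k m} → V) →ₗ (T_{L^{k+1} m} → V)`
      let C : (TSite d (towerP L m k) → V) →ₗ[ℂ] (TSite d (towerP L m (k + 1)) → V) :=
        { toFun := fun g => centreFun (weight L (towerP L m k)) (centre L (towerP L m k)) g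
          map_add' := fun g g' => centreFun_add' L (towerP L m k) g g'
          map_smul' := fun r g => centreFun_smul' L (towerP L m k) r g }
      refine ⟨C ∘ₗ S, fun Rlev f => ?_, fun f x => ?_, fun f => ?_⟩
      · -- `Q′_{k+1} = Q′_k ∘ Q′(Rlev k)` definitionally (finest factor first, `towerP L m (k+1) = fineP L (towerP L m k)` by `rfl`)
        show QprimeTower L m Rlev k (QprimeLin L (towerP L m k) (Rlev k)
            (centreFun (weight L (towerP L m k)) (centre L (towerP L m k)) (S f))) = f
        have h1 : QprimeLin L (towerP L m k) (Rlev k) (centreFun (weight L (towerP L m k)) (centre L (towerP L m k)) (S f)) = S f :=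
          QprimeLin_centreFun L (towerP L m k) (Rlev k) (S f)
        exact (congrArg (QprimeTower L m Rlev k) h1).trans (hS Rlev f)
      · rw [LinearMap.comp_apply]
        show ‖centreFun (weight L (towerP L m k)) (centre L (towerP L m k)) (S f) x‖ ≤ _
        classical
        unfold centreFun
        split_ifs with h
        · rw [norm_smul, weight, inv_inv, norm_pow, Real.norm_natCast, pow_succ, mul_comm (((L : ℝ) ^ d) ^ k), mul_assoc]
          exact mul_le_mul_of_nonneg_left (hSn f _) (by positivity)
        · rw [norm_zero]; positivity
      · rw [LinearMap.comp_apply]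
        show ∑ x : TSite d (fineP L (towerP L m k)), ‖centreFun (weight L (towerP L m k)) (centre L (towerP L m k)) (S f) x‖ ^ 2 = _
        rw [sum_norm_sq_centreFun, hS2 f, pow_succ]
        ring

/-- the sup-norm form of §2's bound: `‖S_k f‖_∞ ≤ (L^d)^k·‖f‖_∞`. [folklore] [cite: Balaban1985BackgroundPropagators, (3.19) p.393] -/
theorem exists_QprimeTower_rightInverse_sup (k : ℕ) :
    ∃ S : (TSite d m → V) →ₗ[ℂ] (TSite d (towerP L m k) → V),
      (∀ (Rlev : (n : ℕ) → Bond d (towerP L m (n + 1)) → V →ₗ[ℂ] V) (f : TSite d m → V), QprimeTower L m Rlev k (S f) = f) ∧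
      ∀ f : TSite d m → V, ‖S f‖ ≤ ((L : ℝ) ^ d) ^ k * ‖f‖ := by
  obtain ⟨S, hS, hSn, -⟩ := exists_QprimeTower_rightInverse L m (V := V) k
  exact ⟨S, hS, fun f => (pi_norm_le_iff_of_nonneg (by positivity)).2 fun x => hSn f x⟩

end Tower

/-! ## §3 The `L²` reading: one section of `QprimeTowerW L m n φ U` for every `φ`, `U` -/

section L2

variable {d : ℕ} (L : ℕ) [NeZero L] (m : Fin d → ℕ) [∀ i, NeZero (m i)] (n : ℕ)
  {𝔸 : Type*} [NormedRing 𝔸] [NormedAlgebra ℂ 𝔸] [CompleteSpace 𝔸]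
  {W : Type*} [NormedAddCommGroup W] [InnerProductSpace ℂ W] {c₀ : ℝ} [Fact (0 < c₀)]

/-- **THE OWNER's CURRENCY: ONE RIGHT INVERSE OF `Q′_{n+1}(U)` ON `L²`, FOR EVERY `φ` AND EVERY `U`, BOUNDED FROM THE SUP NORM.**
There is `S : (T_m → W) →ₗ[ℂ] L²(T_{L^{n+1} m}; c₀; W)` with `QprimeTowerW L m n φ U (S f) = f` for every fibre reading `φ` and every background
`U` of the tower, the VOLUME-FREE identity `‖S f‖² = c₀·(L^d)^{2(n+1)}·Σ_y ‖f(y)‖²` (an `ℓ²`-scaling), and the crude sup-norm bound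
`‖S f‖ ≤ (L^d)^{n+1}·√(c₀·#T_m)·‖f‖_∞` with the COARSE site count (the one-step sup-norm bound is `B9Eq384RemainderLetters.norm_centre_le`).
It inhabits the displayed `(S₁, S₂, CS)` of `B9Thm311SmallFieldCoercivityTower` §3∕§4 with `S₁ = S₂ = S`, `CS = (L^d)^{n+1}√(c₀·#T_m)`. [folklore]
[cite: Balaban1985BackgroundPropagators, (3.19) p.393, (3.11) p.392, (3.15) p.393] -/
theorem exists_QprimeTowerW_rightInverse :
    ∃ S : (TSite d m → W) →ₗ[ℂ] SiteL2K ℂ d (towerP L m (n + 1)) c₀ W,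
      (∀ (φ : W ≃ₗ[ℂ] 𝔸) (U : Bond d (towerP L m (n + 1)) → 𝔸ˣ) (f : TSite d m → W), QprimeTowerW L m n φ U (c₀ := c₀) (S f) = f) ∧
      (∀ f : TSite d m → W, ‖S f‖ ^ 2 = c₀ * (((L : ℝ) ^ d) ^ (n + 1)) ^ 2 * ∑ y : TSite d m, ‖f y‖ ^ 2) ∧
      ∀ f : TSite d m → W, ‖S f‖ ≤ ((L : ℝ) ^ d) ^ (n + 1) * Real.sqrt (c₀ * Fintype.card (TSite d m)) * ‖f‖ := by
  have hc₀ : 0 < c₀ := Fact.out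
  obtain ⟨S, hS, hSn, hS2⟩ := exists_QprimeTower_rightInverse L m (V := W) (n + 1)
  -- the section read on the weighted `L²` synonym
  let SW : (TSite d m → W) →ₗ[ℂ] SiteL2K ℂ d (towerP L m (n + 1)) c₀ W :=
    (WL2.linearEquiv ℂ ℂ (fun _ : TSite d (towerP L m (n + 1)) => c₀)).symm.toLinearMap ∘ₗ S
  -- the volume-free identity: `‖S f‖²_{L²(c₀)} = c₀·(L^d)^{2(n+1)}·Σ_y ‖f(y)‖²` (the section is an `ℓ²`-scaling onto its image)
  have hid : ∀ f : TSite d m → W, ‖SW f‖ ^ 2 = c₀ * (((L : ℝ) ^ d) ^ (n + 1)) ^ 2 * ∑ y : TSite d m, ‖f y‖ ^ 2 := fun f => by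
    rw [WL2.norm_sq]
    show ∑ x : TSite d (towerP L m (n + 1)), c₀ * ‖S f x‖ ^ 2 = _
    rw [← Finset.mul_sum, hS2 f, mul_assoc]
  refine ⟨SW, fun φ U f => ?_, hid, fun f => ?_⟩
  · -- `QprimeTowerW = Q′_{n+1}(transporters of U) ∘ (the identification of L² with the functions)`, definitionally
    show QprimeTower L m _ (n + 1) ((WL2.linearEquiv ℂ ℂ (fun _ : TSite d (towerP L m (n + 1)) => c₀))
        ((WL2.linearEquiv ℂ ℂ (fun _ : TSite d (towerP L m (n + 1)) => c₀)).symm (S f))) = f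
    rw [LinearEquiv.apply_symm_apply]
    exact hS _ f
  · -- the crude sup-norm bound with the COARSE site count `#T_m` (`Σ_y ‖f(y)‖² ≤ #T_m·‖f‖²_∞`)
    have hsum : ∑ y : TSite d m, ‖f y‖ ^ 2 ≤ Fintype.card (TSite d m) * ‖f‖ ^ 2 := by
      calc ∑ y : TSite d m, ‖f y‖ ^ 2 ≤ ∑ _y : TSite d m, ‖f‖ ^ 2 :=
            Finset.sum_le_sum fun y _ => by have := norm_le_pi_norm f y; gcongr
        _ = Fintype.card (TSite d m) * ‖f‖ ^ 2 := by rw [Finset.sum_const, Finset.card_univ, nsmul_eq_mul]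
    have hsq : ‖SW f‖ ^ 2 ≤ (((L : ℝ) ^ d) ^ (n + 1) * Real.sqrt (c₀ * Fintype.card (TSite d m)) * ‖f‖) ^ 2 := by
      rw [hid f,
        show (((L : ℝ) ^ d) ^ (n + 1) * Real.sqrt (c₀ * Fintype.card (TSite d m)) * ‖f‖) ^ 2 =
          (((L : ℝ) ^ d) ^ (n + 1)) ^ 2 * (Real.sqrt (c₀ * Fintype.card (TSite d m))) ^ 2 * ‖f‖ ^ 2 by ring,
        Real.sq_sqrt (by positivity)]
      calc c₀ * (((L : ℝ) ^ d) ^ (n + 1)) ^ 2 * ∑ y : TSite d m, ‖f y‖ ^ 2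
          ≤ c₀ * (((L : ℝ) ^ d) ^ (n + 1)) ^ 2 * (Fintype.card (TSite d m) * ‖f‖ ^ 2) :=
            mul_le_mul_of_nonneg_left hsum (by positivity)
        _ = (((L : ℝ) ^ d) ^ (n + 1)) ^ 2 * (c₀ * Fintype.card (TSite d m)) * ‖f‖ ^ 2 := by ring
    exact (pow_le_pow_iff_left₀ (norm_nonneg _) (by positivity) two_ne_zero).1 hsq

end L2

end Literature.MathematicalPhysics.QuantumFieldTheory.Balaban1983to89.B9Eq319QprimeTowerCentre

end
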